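import Summits.QuantumFields.YangMills.Theorems.BalabanUVNodesN07Thm4Rows152OfDatumCrownPhiAt
import HarnessLib

/-!
# N07 [B11] (= [15] = [Balaban1985Variational]) Sect. F — MODULE 132 (W2′): **ROWS 1–8 + (T2b) AT THE DENTED DATUM FROM THE DOOR ROWS OF AN EXPLICIT MEMBER GAUGE** — MODULE 129
# ✓p759410 `rows152_of_datumCrownPhiAt` with the crown call REMOVED: the pre-composition `h`, the crown's output `u₀` and its rows (exactly `DatumCrownPhiAt`'s tuple at `h⁻¹·u₀`, radius
# generalised to `r`) are BINDERS, so the junction keeps EVERY row of the SAME `u₀` in hand (its (σ1) descent needs them) — the explicit-binder principle of MODULES 130∕131 applied here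

Cell `pub-ymgap`, seat `pub-ymgap-dag-n07-e` g32 (FAN-OUT §N07 row s3; LANE OWNER of the K0 road chart side).  `--kind proof --supports stmt-QuantumFields-20541 --as helper` (K0⁷;
count-neutral).  ONE theorem, 0 `def`.  [15] = [Balaban1985Variational]; [6] = [Balaban1985RegularSpaces]; [II] = [Balaban1984PropagatorsII]; [III] = [Balaban1988Convergent];
[I] = [Balaban1987RG1].

WHY.  129 consumes `hcrown : DatumCrownPhiAt …` internally and re-exports only three rows of the crown's `u₀` (SU, `= 1` off `□₀ᶻ`, (1.29)); the junction's row 9′ ((σ1) adjacent-centre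
descent ✓p755045, guard release) needs further rows of THE SAME `u₀` (the `(−2)`-`msup` row, the (1.38) window Landau system, …), which an `∃ u₀` re-export cannot return.  Here the
junction calls the crown itself, keeps the whole tuple, and feeds it: the theorem takes `h` (SU-valued, `= 1` off `□₀ᶻ`), `u₀` (SU-valued, `= 1` off `□₀ᶻ`) and the crown's rows at
`h⁻¹·u₀` VERBATIM in `DatumCrownPhiAt`'s shapes (radius `r`), plus the numerics `hbud ∕ h4` at `r`, and returns the collar, the door formula at `h⁻¹·u₀` and rows 1–8 + (T2b).  No
`InAk`, no dent premise, no (17)∕(19) letters are needed at this level (they served only the crown call).  Proof = 129's §2 minus the crown paragraph (door ✓p759023 explicit STAGE 3,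
row 8 by MODULE 128 ✓p757399 at the meet's cells with 129's region-row lemma, level letters one level down at the dented top, budgets `t ≤ L⁴`).

WHAT IS PROVED (sorry-free; axioms standard).  ★★★ `rows152_of_recordDoorRows` — see the docstring.
HONEST FRAMING: count-neutral composition; the crown's rows are DISPLAYED premises; row 9′ is NOT produced here; nothing of [15]∕[6]∕[II]∕[I] asserted beyond the cited modules;
`HThm4RecSym152PhiEG` ∕ `HThm4Rec*` UNDISCHARGED; N05 ∕ N07 NOT discharged; K0⁷ ∕ K1⁹ NOT closed; counts unmoved; R4 closes the conditional finite-𝕋⁴ rung `BalabanLadder.UV` ONLY;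
the YM mass gap (Clay) is NOT proved; nothing continuum ∕ ℝ⁴ ∕ OS.  No `def`, no `instance`, no `notation`, no `sorry`.

References: [15] (144) p. 300, (147)–(153) p. 301; [6] Thm. 4 p. 88, Prop. 6 (1.130)–(1.138) pp. 98–99, (1.29) p. 81; [II] (2.10)–(2.12) p. 225; [III] (2.1)–(2.2) p. 254; [I] (0.1)
p. 251, (0.3)–(0.4) pp. 252–253.
-/

set_option autoImplicit false

noncomputable section

open scoped BigOperators Matrix.Norms.L2Operator

namespace Summit.QuantumFields.YangMills.BalabanUVNodes.N07Thm4Rows152OfRecordDoorRows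

open Literature.MathematicalPhysics.QuantumFieldTheory.Balaban1983to89
open Literature.MathematicalPhysics.QuantumFieldTheory.Balaban1983to89.Node00
open Literature.MathematicalPhysics.QuantumFieldTheory.Balaban1983to89.B12RegularSpaces111 (gaugeU expI grad)
open B15Eq112TorusCover (cover)
open B14DomainGeom (Pt Within)
open B8Eq131Cubes (box cube tcube tLo tHi)
open B8Eq131CubesRec (cubeZ tcubeZ)
open B6SectAOperatorsV1 (RE dsE)
open B7Prop1Explicit (e gaugeAct)
open B7Prop1Local (AgreeOn InBox)
open B7Prop2SpecialUnitary (specialUnitaryUnits)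
open BlockAveragingZd (ctrShift)
open B8Ineq132 (covDerivFwd)
open B8Eq140Level (SideTouches)
open B8Eq138LandauZd (logCfg covLap)
open B8Eq138LandauZdRec (IsLandau138WZ)
open B8Eq184Proof (cfgExp)
open B8ScaledSupNorm (msup bondNorm)
open B8Eq146AExpansion (plaqCovDeriv)
open B8Eq143PlaqExpansion (pdiv)
open Literature.MathematicalPhysics.QuantumFieldTheory.BalabanImbrieJaffe1984to88.BIJ85AxialPropagator411 (BondSpace)
open T4Continuum (T4Family)
open N07Thm4RecMemberOfCrown (sitesPerDir_anti pow_mul_eta_inv_eq)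
open N07Thm4Rows152OfDatumCrownPhiAt (mem_domainsOfSeq_Om_of_cover_tcube_subset)

variable (F : T4Family) (N : ℕ) [NeZero N]

set_option maxHeartbeats 800000 in
/-- ★★★ **ROWS 1–8 + (T2b) AT THE DENTED DATUM FROM THE DOOR ROWS OF AN EXPLICIT MEMBER GAUGE** — MODULE 129's theorem with the crown call removed: per datum of the def of record
(binders up to `hmeet`; no letters, no grid row needed here), per pre-composition `h` (SU-valued, `= 1` off `□₀ᶻ`) and crown output `u₀` (SU-valued, `= 1` off `□₀ᶻ`) with the crown's
rows at `h⁻¹·u₀` in `DatumCrownPhiAt`'s VERBATIM shapes at radius `r` (window Landau (1.38), side-touching rows, `vfix`-SU, `AgreeOn`, `(−2)`-`msup`, the two `(−3)` bond norms), and the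
numerics `hbud` (`t ≤ L⁴`) ∕ `h4` at `r`: the collar `π(□̃) ⊆ Ω_{j−1}`, and the door's torus gauge `(u, A)` with the door formula `ι(u(π(x + c_j𝟙))) = ((h⁻¹·u₀) x)⁻¹·vfix x` on `□₀ᶻ`
and rows 1, T1, 3, (T2b), 4–7, 8 (at the meet's cells) of `HThm4RecSym152PhiEG`.
[cite: Balaban1985Variational, (144) p.300, (147)–(153) p.301; Balaban1985RegularSpaces, Thm. 4 p.88, Prop. 6 (1.130)–(1.138) p.99, (1.29) p.81; Balaban1984PropagatorsII, (2.10)–(2.12) p.225; Balaban1988Convergent, (2.1)–(2.2) p.254; Balaban1987RG1, (0.1) p.251, (0.3)–(0.4) pp.252–253] -/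
theorem rows152_of_recordDoorRows {Mc ρ : ℕ} (hρ : F.L ≤ ρ) {κ : ℝ}
    -- the datum (binders of the def of record up to `hmeet` that the rows use)
    (ν : Stage7Numerics) (M : ℕ) (g : ℕ → ℝ) (K k : ℕ) (sq : SeqOfRecord F ν M g K k) (hsep : Sect2.SeqSeparated ν.M₁ sq) (hM₁ : 0 < ν.M₁)
    (hfl : (11 * 4 + 4 * ρ + Mc + 3) * F.L ≤ ν.M₁) (hnw : Mc + 11 * 4 + 6 * ρ ≤ (F.P K).sitesPerDir k)
    (ε : ℕ → ℝ) (U : GaugeField (F.P K) 0 (SU N))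
    (j : ℕ) (hk : j ≤ (F.P K).m + (F.P K).K) (hj1 : 1 ≤ j) (hjk : j ≤ k) (idx : Pt (F.P K).d)
    (hmeet : ∃ x ∈ box (F.P K).L (cornerP (F.P K) Mc ρ idx) (sideP (F.P K) Mc ρ) j, ∃ y : Pt (F.P K).d, cover (F.P K) y ∈ sq.Ω j ∧ Within ((3 : ℕ) : ℤ) x y)
    -- the junction's pre-composition `h` and the crown's output `u₀`
    (h : B7Prop1Explicit.Site (F.P K).d → (MatA N)ˣ) (hSU : ∀ x, h x ∈ specialUnitaryUnits (Fin N))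
    (hh1 : ∀ x, x ∉ (recordCubePZ (F.P K) j hj1 hk Mc ρ hρ idx ((domainsOfSeq sq.Ω j hk).Om j)).sq 0 → h x = 1)
    (u₀ : B7Prop1Explicit.Site (F.P K).d → (MatA N)ˣ) (hu₀ : ∀ x, u₀ x ∈ specialUnitaryUnits (Fin N)) (hoff₀ : ∀ x, x ∉ (recordCubePZ (F.P K) j hj1 hk Mc ρ hρ idx ((domainsOfSeq sq.Ω j hk).Om j)).sq 0 → u₀ x = 1)
    -- the crown's rows at `h⁻¹·u₀` (VERBATIM `DatumCrownPhiAt` shapes, radius `r`)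
    {r : ℝ} (hr : 0 ≤ r)
    (hLanW : letI : CStarAlgebra (MatA N) := {};
      IsLandau138WZ (F.P K).L j ((F.P K).eta j) ((recordCubePZ (F.P K) j hj1 hk Mc ρ hρ idx ((domainsOfSeq sq.Ω j hk).Om j)).sq 0) (recordCubePZ (F.P K) j hj1 hk Mc ρ hρ idx ((domainsOfSeq sq.Ω j hk).Om j)).lamS (1 : B7Prop1Explicit.Site (F.P K).d → Fin (F.P K).d → (MatA N)ˣ) ((recordCubePZ (F.P K) j hj1 hk Mc ρ hρ idx ((domainsOfSeq sq.Ω j hk).Om j)).fixed (fun x μ => ιSU N (U ⟨cover (F.P K) (x + fun _ => (ctrShift (F.P K).L j : ℤ)), μ⟩)) (h⁻¹ * u₀)))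
    (hrows : letI : CStarAlgebra (MatA N) := {};
      ∀ j', j' ≤ j → ∀ b ∈ {b : B7Prop1Explicit.Site (F.P K).d × Fin (F.P K).d | SideTouches ((recordCubePZ (F.P K) j hj1 hk Mc ρ hρ idx ((domainsOfSeq sq.Ω j hk).Om j)).sq j') b.1 b.2},
        (recordCubePZ (F.P K) j hj1 hk Mc ρ hρ idx ((domainsOfSeq sq.Ω j hk).Om j)).fixed (fun x μ => ιSU N (U ⟨cover (F.P K) (x + fun _ => (ctrShift (F.P K).L j : ℤ)), μ⟩)) (h⁻¹ * u₀) b.1 b.2 = cfgExp ((F.P K).eta j) (logCfg ((F.P K).eta j) ((recordCubePZ (F.P K) j hj1 hk Mc ρ hρ idx ((domainsOfSeq sq.Ω j hk).Om j)).fixed (fun x μ => ιSU N (U ⟨cover (F.P K) (x + fun _ => (ctrShift (F.P K).L j : ℤ)), μ⟩)) (h⁻¹ * u₀))) b.1 b.2 ∧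
          IsSelfAdjoint (logCfg ((F.P K).eta j) ((recordCubePZ (F.P K) j hj1 hk Mc ρ hρ idx ((domainsOfSeq sq.Ω j hk).Om j)).fixed (fun x μ => ιSU N (U ⟨cover (F.P K) (x + fun _ => (ctrShift (F.P K).L j : ℤ)), μ⟩)) (h⁻¹ * u₀)) b.1 b.2) ∧
          ‖logCfg ((F.P K).eta j) ((recordCubePZ (F.P K) j hj1 hk Mc ρ hρ idx ((domainsOfSeq sq.Ω j hk).Om j)).fixed (fun x μ => ιSU N (U ⟨cover (F.P K) (x + fun _ => (ctrShift (F.P K).L j : ℤ)), μ⟩)) (h⁻¹ * u₀)) b.1 b.2‖ ≤ r * (((F.P K).L : ℝ) ^ j' * (F.P K).eta j)⁻¹)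
    (hsuW : letI : CStarAlgebra (MatA N) := {};
      ∀ x, (((recordCubePZ (F.P K) j hj1 hk Mc ρ hρ idx ((domainsOfSeq sq.Ω j hk).Om j)).vfix (fun x μ => ιSU N (U ⟨cover (F.P K) (x + fun _ => (ctrShift (F.P K).L j : ℤ)), μ⟩)))⁻¹ * (h⁻¹ * u₀)) x ∈ specialUnitaryUnits (Fin N))
    (hagree : letI : CStarAlgebra (MatA N) := {};
      AgreeOn (B8Ineq130Rec.tlo (F.P K).L (tLo (cornerP (F.P K) Mc ρ idx) ρ) j) (B8Ineq130Rec.thi (F.P K).L (tHi (cornerP (F.P K) Mc ρ idx) (sideP (F.P K) Mc ρ) ρ) j)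
      (gaugeAct (((recordCubePZ (F.P K) j hj1 hk Mc ρ hρ idx ((domainsOfSeq sq.Ω j hk).Om j)).vfix (fun x μ => ιSU N (U ⟨cover (F.P K) (x + fun _ => (ctrShift (F.P K).L j : ℤ)), μ⟩)))⁻¹ * (h⁻¹ * u₀))⁻¹ (fun x μ => ιSU N (U ⟨cover (F.P K) (x + fun _ => (ctrShift (F.P K).L j : ℤ)), μ⟩))) ((recordCubePZ (F.P K) j hj1 hk Mc ρ hρ idx ((domainsOfSeq sq.Ω j hk).Om j)).fixed (fun x μ => ιSU N (U ⟨cover (F.P K) (x + fun _ => (ctrShift (F.P K).L j : ℤ)), μ⟩)) (h⁻¹ * u₀)))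
    (hmsup : letI : CStarAlgebra (MatA N) := {};
      msup (F.P K).L j ((F.P K).eta j) (-(2 : ℝ))
          (fun j' (q : Fin (F.P K).d × Fin (F.P K).d × B7Prop1Explicit.Site (F.P K).d) => SideTouches ((recordCubePZ (F.P K) j hj1 hk Mc ρ hρ idx ((domainsOfSeq sq.Ω j hk).Om j)).sq j') q.2.2 q.2.1)
          (fun q => covDerivFwd ((F.P K).eta j) (1 : B7Prop1Explicit.Site (F.P K).d → Fin (F.P K).d → (MatA N)ˣ) q.1
            (fun z => (recordCubePZ (F.P K) j hj1 hk Mc ρ hρ idx ((domainsOfSeq sq.Ω j hk).Om j)).expo ((F.P K).eta j) (fun x μ => ιSU N (U ⟨cover (F.P K) (x + fun _ => (ctrShift (F.P K).L j : ℤ)), μ⟩)) (h⁻¹ * u₀) z q.2.1) q.2.2) ≤ r)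
    (hbn1 : letI : CStarAlgebra (MatA N) := {};
      bondNorm (F.P K).L j ((F.P K).eta j) (-(3 : ℝ)) (recordCubePZ (F.P K) j hj1 hk Mc ρ hρ idx ((domainsOfSeq sq.Ω j hk).Om j)).sq
          (fun x μ => pdiv ((F.P K).eta j) (1 : B7Prop1Explicit.Site (F.P K).d → Fin (F.P K).d → (MatA N)ˣ)
            (plaqCovDeriv ((F.P K).eta j) (1 : B7Prop1Explicit.Site (F.P K).d → Fin (F.P K).d → (MatA N)ˣ) ((recordCubePZ (F.P K) j hj1 hk Mc ρ hρ idx ((domainsOfSeq sq.Ω j hk).Om j)).expo ((F.P K).eta j) (fun x μ => ιSU N (U ⟨cover (F.P K) (x + fun _ => (ctrShift (F.P K).L j : ℤ)), μ⟩)) (h⁻¹ * u₀))) μ x) ≤ r)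
    (hbn2 : letI : CStarAlgebra (MatA N) := {};
      bondNorm (F.P K).L j ((F.P K).eta j) (-(3 : ℝ)) (recordCubePZ (F.P K) j hj1 hk Mc ρ hρ idx ((domainsOfSeq sq.Ω j hk).Om j)).sq
          (fun x μ => covLap ((F.P K).eta j) (1 : B7Prop1Explicit.Site (F.P K).d → Fin (F.P K).d → (MatA N)ˣ)
            (fun z => (recordCubePZ (F.P K) j hj1 hk Mc ρ hρ idx ((domainsOfSeq sq.Ω j hk).Om j)).expo ((F.P K).eta j) (fun x μ => ιSU N (U ⟨cover (F.P K) (x + fun _ => (ctrShift (F.P K).L j : ℤ)), μ⟩)) (h⁻¹ * u₀) z μ) x) ≤ r)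
    -- per-datum numerics at the radius `r`
    (hbud : ∀ t : ℝ, 0 ≤ t → t ≤ (F.L : ℝ) ^ 4 → 2 * (r * t) < κ * ε j)
    (h4 : 4 * ((N : ℝ) * r) < 2 * Real.pi) :
    letI : CStarAlgebra (MatA N) := {};
    cover (F.P K) '' tcube (F.P K).L (cornerP (F.P K) Mc ρ idx) (sideP (F.P K) Mc ρ) ρ j ⊆
        (if j - 1 = 0 then suppDomOfRecord F ν K sq.Ω else sq.Ω (j - 1)) ∧
    ∃ (u : GaugeTransf (F.P K) 0 (SU N)) (A : PBond (F.P K) 0 → MatA N),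
      -- the door formula on `□₀ᶻ`
      (∀ x, x ∈ (recordCubePZ (F.P K) j hj1 hk Mc ρ hρ idx ((domainsOfSeq sq.Ω j hk).Om j)).sq 0 → ιSU N (u (cover (F.P K) (x + fun _ => (ctrShift (F.P K).L j : ℤ)))) = ((h⁻¹ * u₀) x)⁻¹ * (recordCubePZ (F.P K) j hj1 hk Mc ρ hρ idx ((domainsOfSeq sq.Ω j hk).Om j)).vfix (fun x μ => ιSU N (U ⟨cover (F.P K) (x + fun _ => (ctrShift (F.P K).L j : ℤ)), μ⟩)) x) ∧
      -- rows 1–8 + (T2b) of `HThm4RecSym152PhiEG` for `(u, A)`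
      (∀ b ∈ (Sect2.regionOfSet (F.P K) (cover (F.P K) '' box (F.P K).L (cornerP (F.P K) Mc ρ idx) (sideP (F.P K) Mc ρ) j)).bonds,
        gaugeU (fun x => ιSU N (u x)) (fun b' => ιSU N (U b')) b = expI ((F.P K).eta j) (A b)) ∧
      (∀ b ∈ (Sect2.regionOfSet (F.P K) (cover (F.P K) '' cube (F.P K).L (cornerP (F.P K) Mc ρ idx) (sideP (F.P K) Mc ρ) ρ j 0)).bonds,
        gaugeU (fun x => ιSU N (u x)) (fun b' => ιSU N (U b')) b = expI ((F.P K).eta j) (A b)) ∧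
      (∀ j', j' ≤ j →
        ∀ b ∈ (Sect2.regionOfSet (F.P K) (cover (F.P K) '' cube (F.P K).L (cornerP (F.P K) Mc ρ idx) (sideP (F.P K) Mc ρ) ρ j j')).bonds,
          ‖A b‖ < κ * ε j * ((F.P K).L : ℝ) ^ (j - j')) ∧
      (∀ j', j' ≤ j →
        ∀ q ∈ (Sect2.regionOfSet (F.P K) (cover (F.P K) '' cube (F.P K).L (cornerP (F.P K) Mc ρ idx) (sideP (F.P K) Mc ρ) ρ j j')).dpairs,
          ‖grad ((F.P K).eta j) q.2.1 (fun y => A ⟨y, q.2.2⟩) q.1‖ < κ * ε j * ((F.P K).L : ℝ) ^ (2 * (j - j'))) ∧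
      (∀ b ∈ (Sect2.regionOfSet (F.P K) (cover (F.P K) '' box (F.P K).L (cornerP (F.P K) Mc ρ idx) (sideP (F.P K) Mc ρ) j)).bonds,
        ‖A b‖ < κ * ε j) ∧
      (∀ q ∈ (Sect2.regionOfSet (F.P K) (cover (F.P K) '' box (F.P K).L (cornerP (F.P K) Mc ρ idx) (sideP (F.P K) Mc ρ) j)).dpairs,
        ‖grad ((F.P K).eta j) q.2.1 (fun y => A ⟨y, q.2.2⟩) q.1‖ < κ * ε j) ∧
      (∀ b ∈ Sect2.bondsDeep (cover (F.P K) '' box (F.P K).L (cornerP (F.P K) Mc ρ idx) (sideP (F.P K) Mc ρ) j),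
        ‖Sect2.codiffCurlA ((F.P K).eta j) A b.src b.dir‖ < κ * ε j) ∧
      (∀ b ∈ Sect2.bondsDeep (cover (F.P K) '' box (F.P K).L (cornerP (F.P K) Mc ρ idx) (sideP (F.P K) Mc ρ) j),
        ‖∑ ν' : Fin (F.P K).d, (((F.P K).eta j : ℝ) : ℂ)⁻¹ •
            (grad ((F.P K).eta j) ν' (fun y => A ⟨y, b.dir⟩) (b.src.unshift ν') - grad ((F.P K).eta j) ν' (fun y => A ⟨y, b.dir⟩) b.src)‖ < κ * ε j) ∧
      (∀ φ : MatA N →L[ℂ] ℂ,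
        RE (domainsMeet (cubeDomains (F.P K) (cornerP (F.P K) Mc ρ idx) (sideP (F.P K) Mc ρ) ρ j hk) (domainsOfSeq sq.Ω j hk)) ((F.P K).eta j)⁻¹
            (dsE ((F.P K).eta j)⁻¹ (WithLp.toLp 2 fun b => (φ (A b)).re : BondSpace (F.P K))) = 0 ∧
        RE (domainsMeet (cubeDomains (F.P K) (cornerP (F.P K) Mc ρ idx) (sideP (F.P K) Mc ρ) ρ j hk) (domainsOfSeq sq.Ω j hk)) ((F.P K).eta j)⁻¹
            (dsE ((F.P K).eta j)⁻¹ (WithLp.toLp 2 fun b => (φ (A b)).im : BondSpace (F.P K))) = 0) := by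
  letI : CStarAlgebra (MatA N) := {}
  -- ### letters (as in ✓p745548 ∕ MODULE 129)
  have hL1 : (1 : ℝ) ≤ F.L := by exact_mod_cast (F.P 0).L_pos
  have hd : 2 ≤ (F.P K).d := by rw [T4Family.P_d]; norm_num
  have hρ' : (F.P K).L ≤ ρ := by rw [T4Family.P_L]; exact hρ
  have hρ1 : 1 ≤ ρ := le_trans (le_trans (by norm_num) (F.P K).hL.2) hρ'
  -- ### (c) the non-wrapping of `□̃` from the guard
  have hg : Mc + 11 * (F.P K).d + 6 * ρ ≤ (F.P K).sitesPerDir j := by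
    rw [T4Family.P_d]; exact hnw.trans (sitesPerDir_anti (F.P K) hjk)
  have hinj := injOn_cover_tcube_of_guard (P := F.P K) (a := idx) hk hg
  have hinj0 : Set.InjOn (cover (F.P K)) (cube (F.P K).L (cornerP (F.P K) Mc ρ idx) (sideP (F.P K) Mc ρ) ρ j 0) :=
    hinj.mono (B8Eq131Cubes.cube_subset_tcube (F.P K).hL.2 hρ1 (Nat.zero_le _))
  -- ### (b) the collar inclusion from the meeting witness (as in ✓p745548)
  obtain ⟨x, hx, y, hy, hxy⟩ := hmeet
  have hcollar : cover (F.P K) '' tcube (F.P K).L (cornerP (F.P K) Mc ρ idx) (sideP (F.P K) Mc ρ) ρ j ⊆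
      (if j - 1 = 0 then suppDomOfRecord F ν K sq.Ω else sq.Ω (j - 1)) := by
    rcases Nat.lt_or_ge j 2 with hj2 | hj2
    · have hj1' : j = 1 := by omega
      subst hj1'
      rw [if_pos rfl, suppDomOfRecord_eq]
      rintro _ ⟨z, hz, rfl⟩
      have hz' : z ∈ (cubeIdxP' (F.P K) 1 le_rfl Mc ρ idx).Ω 0 := by rw [cubeIdxP'_Ω]; exact hz
      have hw := within_of_mem_Ω_cubeIdxP'_of_within_box (P := F.P K) le_rfl hx hxy hz'
      refine cover_mem_hullD_one_of_within hM₁ hy (hw.mono ?_)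
      rw [B14.Eq213MaximalDomains.side, pow_one, T4Family.P_d, T4Family.P_L]
      have hf : (((11 * 4 + 4 * ρ + Mc + 3) * F.L : ℕ) : ℤ) ≤ ν.M₁ := by exact_mod_cast hfl
      have hL1z : (1 : ℤ) ≤ F.L := by exact_mod_cast (F.P 0).L_pos
      push_cast at hf ⊢
      nlinarith
    · rw [if_neg (by omega)]
      have hfloor : 11 * (F.P K).d + 4 * ρ + Mc + 3 ≤ ν.M₁ := by
        rw [T4Family.P_d]
        exact le_trans (Nat.le_mul_of_pos_right _ (F.P 0).L_pos) hfl
      have h := Sect2.cover_image_Ω_cubeIdxP'_subset_of_within_mem_box (P := F.P K) hM₁ sq hsep hfloor hj2 hjk hx hy hxy 0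
      rwa [cubeIdxP'_Ω] at h
  have hηpos : 0 < (F.P K).eta j := B3GkZeroTorusRescaled.eta_pos (F.P K) j
  -- ### the explicit-`u` precomp door at `um := h⁻¹·u₀`
  have humSU : ∀ x, (h⁻¹ * u₀) x ∈ specialUnitaryUnits (Fin N) := fun x => by
    rw [Pi.mul_apply, Pi.inv_apply]; exact Subgroup.mul_mem _ (Subgroup.inv_mem _ (hSU x)) (hu₀ x)
  have humoff : ∀ x, x ∉ (recordCubePZ (F.P K) j hj1 hk Mc ρ hρ idx ((domainsOfSeq sq.Ω j hk).Om j)).sq 0 → (h⁻¹ * u₀) x = 1 := fun x hx => by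
    rw [Pi.mul_apply, Pi.inv_apply, hh1 x hx, hoff₀ x hx, inv_one, one_mul]
  obtain ⟨u, A, h1, hlev, h2, h3, h4c, h4'', hA7, h5, hsid, -, -, hgradAll, -⟩ :=
    exists_localGauge152_recTower_member_grad_precomp_explicit (P := F.P K) (N := N) hd (recordCubePZ (F.P K) j hj1 hk Mc ρ hρ idx ((domainsOfSeq sq.Ω j hk).Om j)) U (n := j) rfl hr (h⁻¹ * u₀)
      ⟨humSU, humoff, hLanW, hrows, hsuW, hagree, hmsup, hbn1, hbn2⟩ hinj h4
  -- ### row 8 ((153)) at the MEET's own cells (MODULE 128)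
  have hA0 : ∀ x, x ∈ (recordCubePZ (F.P K) j hj1 hk Mc ρ hρ idx ((domainsOfSeq sq.Ω j hk).Om j)).sq 0 → ∀ κ', A ⟨cover (F.P K) (x + fun _ => (ctrShift (F.P K).L j : ℤ)), κ'⟩ =
      logCfg ((F.P K).eta j) ((recordCubePZ (F.P K) j hj1 hk Mc ρ hρ idx ((domainsOfSeq sq.Ω j hk).Om j)).fixed (fun x μ => ιSU N (U ⟨cover (F.P K) (x + fun _ => (ctrShift (F.P K).L j : ℤ)), μ⟩)) (h⁻¹ * u₀)) x κ' :=
    fun x hx κ' => hA7 x (CubeB8DZ.sq_zero_subset_tcube (F.P K).hL.1 (F.P K).hL.2 _ hx) κ'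
  have hnest : ∀ i : ℕ, 1 ≤ i → i + 1 ≤ j - 1 → sq.Ω (i + 1) ⊆ sq.Ω i := fun i hi1 hij => sq.chain.Ω_succ_subset_Ω hi1 (by omega)
  have hΩ : ∀ j', 1 ≤ j' → j' < j → ∀ z ∈ (recordCubePZ (F.P K) j hj1 hk Mc ρ hρ idx ((domainsOfSeq sq.Ω j hk).Om j)).lamS j',
      coverAt (F.P K) j' (z + fun _ => ((ctrShift (F.P K).L (j - j') : ℕ) : ℤ)) ∈ (domainsOfSeq sq.Ω j hk).Om j' := by
    intro j' hj'1 hj' z hz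
    have hz' := hz
    simp only [CubeB8DZ.lamS, recordCubePZ_k, hj'.le, if_true, Set.mem_setOf_eq] at hz'
    have hbox : InBox (B8Eq131Cubes.sqLo (F.P K).L (cornerP (F.P K) Mc ρ idx) ρ j j') (B8Eq131Cubes.sqHi (F.P K).L (cornerP (F.P K) Mc ρ idx) (sideP (F.P K) Mc ρ) ρ j j')
        (z + fun _ => ((ctrShift (F.P K).L (j - j') : ℕ) : ℤ)) := by
      have hb := hz'.1
      rw [show (recordCubePZ (F.P K) j hj1 hk Mc ρ hρ idx ((domainsOfSeq sq.Ω j hk).Om j)).a = cornerP (F.P K) Mc ρ idx from rfl, show (recordCubePZ (F.P K) j hj1 hk Mc ρ hρ idx ((domainsOfSeq sq.Ω j hk).Om j)).ρ = ρ from rfl, show (recordCubePZ (F.P K) j hj1 hk Mc ρ hρ idx ((domainsOfSeq sq.Ω j hk).Om j)).M = sideP (F.P K) Mc ρ from rfl,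
        B8Eq131CubesRecDictionary.inBox_sqZ_iff_add_ctrShift] at hb
      exact hb
    have hcollar' : cover (F.P K) '' tcube (F.P K).L (cornerP (F.P K) Mc ρ idx) (sideP (F.P K) Mc ρ) ρ j ⊆ sq.Ω (j - 1) := by
      have hj2 : j - 1 ≠ 0 := by omega
      rw [if_neg hj2] at hcollar; exact hcollar
    exact mem_domainsOfSeq_Om_of_cover_tcube_subset F K sq.Ω hk hnest hρ1 hcollar' hj'1 hj' hbox
  have hRE := fun φ => RE_dsE_re_im_eq_zero_meet_of_isLandau138Z_recordCubePZ hj1 hk hρ idx (domainsOfSeq sq.Ω j hk) hinj0 hA0 h5 hΩ φ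
  -- ### the strict budgets (`t ≤ L⁴`)
  have hLK : (1 : ℝ) ≤ ((F.P K).L : ℝ) := by rw [T4Family.P_L]; exact hL1
  have hL0 : (0 : ℝ) ≤ ((F.P K).L : ℝ) := by linarith
  have hrow : ∀ t : ℝ, 0 ≤ t → t ≤ ((F.P K).L : ℝ) ^ 4 → 2 * (r * t) < κ * ε j := by
    intro t ht htL
    rw [T4Family.P_L] at htL; exact hbud t ht htL
  have hLpow : ∀ i : ℕ, i ≤ 4 → ((F.P K).L : ℝ) ^ i ≤ ((F.P K).L : ℝ) ^ 4 := fun i hi => pow_le_pow_right₀ hLK hi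
  -- ### the level letters on `□_{j′}ᶻ` for EVERY `j′ ≤ j`, the top read one level down
  have hsqZ : ∀ j', j' < j → (recordCubePZ (F.P K) j hj1 hk Mc ρ hρ idx ((domainsOfSeq sq.Ω j hk).Om j)).sq j' = cubeZ (F.P K).L (cornerP (F.P K) Mc ρ idx) (sideP (F.P K) Mc ρ) ρ j j' := fun j' hj' => by
    rw [recordCubePZ_sq_of_lt j hj1 hk Mc ρ hρ idx _ hj', propCubePZ_sq_eq_cubeZ (P := F.P K) j hj1 Mc ρ hρ idx hj'.le]
  have hdown : ∀ j', j' ≤ j → ∃ i, i ≤ j ∧ i < j ∧ i ≤ j' ∧ j' ≤ i + 1 ∧ (j' < j → i = j') := fun j' hj' => by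
    rcases Nat.lt_or_ge j' j with hlt | hge
    · exact ⟨j', hj', hlt, le_rfl, Nat.le_succ _, fun _ => rfl⟩
    · exact ⟨j - 1, by omega, by omega, by omega, by omega, fun h => absurd h (by omega)⟩
  have hlevZ : ∀ j', j' ≤ j → ∀ (xx : Pt (F.P K).d) (μ : Fin (F.P K).d),
      xx ∈ cubeZ (F.P K).L (cornerP (F.P K) Mc ρ idx) (sideP (F.P K) Mc ρ) ρ j j' → xx + e μ ∈ cubeZ (F.P K).L (cornerP (F.P K) Mc ρ idx) (sideP (F.P K) Mc ρ) ρ j j' →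
      ‖A ⟨cover (F.P K) (xx + fun _ => (ctrShift (F.P K).L j : ℤ)), μ⟩‖ ≤ 2 * (r * (((F.P K).L : ℝ) * (((F.P K).L : ℝ) ^ j' * (F.P K).eta j)⁻¹)) := by
    intro j' hj' xx μ hxx hxx'
    obtain ⟨i, hij, hilt, hij', hj'i, -⟩ := hdown j' hj'
    have hsub : cubeZ (F.P K).L (cornerP (F.P K) Mc ρ idx) (sideP (F.P K) Mc ρ) ρ j j' ⊆ (recordCubePZ (F.P K) j hj1 hk Mc ρ hρ idx ((domainsOfSeq sq.Ω j hk).Om j)).sq i := by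
      rw [hsqZ i hilt]; exact B8Eq131CubesRec.cube_anti (F.P K).hL.1 hij' hj'
    have hb := hlev i hij xx μ (hsub hxx) (hsub hxx')
    refine hb.trans ?_
    -- `(L^i η)⁻¹ ≤ L·(L^{j′} η)⁻¹` for `j′ ≤ i + 1`
    have hLi : (0 : ℝ) < ((F.P K).L : ℝ) ^ i := by positivity
    have hkey : (((F.P K).L : ℝ) ^ i * (F.P K).eta j)⁻¹ ≤ ((F.P K).L : ℝ) * (((F.P K).L : ℝ) ^ j' * (F.P K).eta j)⁻¹ := by
      rw [mul_inv, mul_inv, ← mul_assoc]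
      refine mul_le_mul_of_nonneg_right ?_ (inv_nonneg.2 hηpos.le)
      rw [inv_le_iff_one_le_mul₀ hLi]
      have : (1 : ℝ) ≤ ((F.P K).L : ℝ) * (((F.P K).L : ℝ) ^ j')⁻¹ * ((F.P K).L : ℝ) ^ i := by
        have hpow : ((F.P K).L : ℝ) ^ j' ≤ ((F.P K).L : ℝ) ^ (i + 1) := pow_le_pow_right₀ hLK hj'i
        have hLj : (0 : ℝ) < ((F.P K).L : ℝ) ^ j' := by positivity
        calc (1 : ℝ) = ((F.P K).L : ℝ) ^ j' * (((F.P K).L : ℝ) ^ j')⁻¹ := by rw [mul_inv_cancel₀ hLj.ne']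
          _ ≤ ((F.P K).L : ℝ) ^ (i + 1) * (((F.P K).L : ℝ) ^ j')⁻¹ := mul_le_mul_of_nonneg_right hpow (inv_nonneg.2 hLj.le)
          _ = ((F.P K).L : ℝ) * (((F.P K).L : ℝ) ^ j')⁻¹ * ((F.P K).L : ℝ) ^ i := by ring
      exact this
    exact mul_le_mul_of_nonneg_left (mul_le_mul_of_nonneg_left hkey hr) (by norm_num)
  have hgradZ : ∀ j', j' ≤ j → ∀ (xx : Pt (F.P K).d) (μ ν' : Fin (F.P K).d),
      xx ∈ cubeZ (F.P K).L (cornerP (F.P K) Mc ρ idx) (sideP (F.P K) Mc ρ) ρ j j' → xx + e μ ∈ cubeZ (F.P K).L (cornerP (F.P K) Mc ρ idx) (sideP (F.P K) Mc ρ) ρ j j' →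
      ‖logCfg ((F.P K).eta j) ((recordCubePZ (F.P K) j hj1 hk Mc ρ hρ idx ((domainsOfSeq sq.Ω j hk).Om j)).fixed (fun x μ => ιSU N (U ⟨cover (F.P K) (x + fun _ => (ctrShift (F.P K).L j : ℤ)), μ⟩)) (h⁻¹ * u₀)) (xx + e μ) ν' - logCfg ((F.P K).eta j) ((recordCubePZ (F.P K) j hj1 hk Mc ρ hρ idx ((domainsOfSeq sq.Ω j hk).Om j)).fixed (fun x μ => ιSU N (U ⟨cover (F.P K) (x + fun _ => (ctrShift (F.P K).L j : ℤ)), μ⟩)) (h⁻¹ * u₀)) xx ν'‖ ≤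
        (F.P K).eta j * (2 * ((F.P K).eta j * r * (((F.P K).L : ℝ) ^ 2 * ((((F.P K).L : ℝ) ^ j' * (F.P K).eta j) ^ 2)⁻¹)) * ((F.P K).eta j)⁻¹) := by
    intro j' hj' xx μ ν' hxx hxx'
    obtain ⟨i, hij, hilt, hij', hj'i, -⟩ := hdown j' hj'
    have hsub : cubeZ (F.P K).L (cornerP (F.P K) Mc ρ idx) (sideP (F.P K) Mc ρ) ρ j j' ⊆ (recordCubePZ (F.P K) j hj1 hk Mc ρ hρ idx ((domainsOfSeq sq.Ω j hk).Om j)).sq i := by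
      rw [hsqZ i hilt]; exact B8Eq131CubesRec.cube_anti (F.P K).hL.1 hij' hj'
    have hb := hgradAll i hij xx μ ν' (hsub hxx) (hsub hxx')
    refine hb.trans ?_
    have hηpos' : 0 < (F.P K).eta j := hηpos
    have hre : ∀ X : ℝ, (F.P K).eta j * (X * ((F.P K).eta j)⁻¹) = X := fun X => by field_simp
    rw [hre]
    -- `((L^i η)²)⁻¹ ≤ L²·((L^{j′} η)²)⁻¹`
    have hLi : (0 : ℝ) < (((F.P K).L : ℝ) ^ i * (F.P K).eta j) ^ 2 := by positivity
    have hLj : (0 : ℝ) < (((F.P K).L : ℝ) ^ j' * (F.P K).eta j) ^ 2 := by positivity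
    have hkey : ((((F.P K).L : ℝ) ^ i * (F.P K).eta j) ^ 2)⁻¹ ≤ ((F.P K).L : ℝ) ^ 2 * ((((F.P K).L : ℝ) ^ j' * (F.P K).eta j) ^ 2)⁻¹ := by
      rw [inv_le_iff_one_le_mul₀ hLi]
      have hpow : (((F.P K).L : ℝ) ^ j' * (F.P K).eta j) ^ 2 ≤ ((F.P K).L : ℝ) ^ 2 * (((F.P K).L : ℝ) ^ i * (F.P K).eta j) ^ 2 := by
        have h1 : ((F.P K).L : ℝ) ^ j' ≤ ((F.P K).L : ℝ) * ((F.P K).L : ℝ) ^ i := by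
          rw [← pow_succ']; exact pow_le_pow_right₀ hLK hj'i
        have h2 : ((F.P K).L : ℝ) ^ j' * (F.P K).eta j ≤ ((F.P K).L : ℝ) * ((F.P K).L : ℝ) ^ i * (F.P K).eta j :=
          mul_le_mul_of_nonneg_right h1 hηpos'.le
        have h0 : 0 ≤ ((F.P K).L : ℝ) ^ j' * (F.P K).eta j := by positivity
        calc (((F.P K).L : ℝ) ^ j' * (F.P K).eta j) ^ 2 ≤ (((F.P K).L : ℝ) * ((F.P K).L : ℝ) ^ i * (F.P K).eta j) ^ 2 := pow_le_pow_left₀ h0 h2 2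
          _ = ((F.P K).L : ℝ) ^ 2 * (((F.P K).L : ℝ) ^ i * (F.P K).eta j) ^ 2 := by ring
      calc (1 : ℝ) = (((F.P K).L : ℝ) ^ j' * (F.P K).eta j) ^ 2 * ((((F.P K).L : ℝ) ^ j' * (F.P K).eta j) ^ 2)⁻¹ := by rw [mul_inv_cancel₀ hLj.ne']
        _ ≤ ((F.P K).L : ℝ) ^ 2 * (((F.P K).L : ℝ) ^ i * (F.P K).eta j) ^ 2 * ((((F.P K).L : ℝ) ^ j' * (F.P K).eta j) ^ 2)⁻¹ :=
            mul_le_mul_of_nonneg_right hpow (inv_nonneg.2 hLj.le)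
        _ = ((F.P K).L : ℝ) ^ 2 * ((((F.P K).L : ℝ) ^ j' * (F.P K).eta j) ^ 2)⁻¹ * (((F.P K).L : ℝ) ^ i * (F.P K).eta j) ^ 2 := by ring
    have h0 : 0 ≤ (F.P K).eta j * r := by positivity
    exact mul_le_mul_of_nonneg_left (mul_le_mul_of_nonneg_left hkey h0) (by norm_num)
  -- ### assemble
  refine ⟨hcollar, u, A, hsid, ?_, h1, ?_, ?_, ?_, ?_, ?_, ?_, hRE⟩
  · -- row 1: the box lies in `□₀`
    intro b hb
    exact h1 b (Sect2.regionOfSet_bonds_mono (Set.image_mono (B8Eq131Cubes.box_subset_cube (Nat.zero_le j))) hb)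
  · -- row 3: torus letters from the ℤᵈ ones on `□_{j′}ᶻ`, `(L^{j′}η_j)⁻¹ = L^{j−j′}`, budget `t := L`
    intro j' hj' b hb
    have hb' := norm_le_of_mem_regionOfSet_cover_image_cube (N := N) hρ1 hinj
      (R := fun j' => 2 * (r * (((F.P K).L : ℝ) * (((F.P K).L : ℝ) ^ j' * (F.P K).eta j)⁻¹))) hlevZ hj' b hb
    refine hb'.trans_lt ?_
    show 2 * (r * (((F.P K).L : ℝ) * (((F.P K).L : ℝ) ^ j' * (F.P K).eta j)⁻¹)) < κ * ε j * ((F.P K).L : ℝ) ^ (j - j')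
    rw [pow_mul_eta_inv_eq (F.P K) hj']
    have hpos : (0 : ℝ) < ((F.P K).L : ℝ) ^ (j - j') := by positivity
    have := hrow _ hL0 (by simpa using hLpow 1 (by norm_num))
    calc 2 * (r * (((F.P K).L : ℝ) * ((F.P K).L : ℝ) ^ (j - j'))) = 2 * (r * ((F.P K).L : ℝ)) * ((F.P K).L : ℝ) ^ (j - j') := by ring
      _ < κ * ε j * ((F.P K).L : ℝ) ^ (j - j') := mul_lt_mul_of_pos_right this hpos
  · -- (T2b): derivative stencils from the ℤᵈ letters, `((L^{j′}η_j)²)⁻¹ = (L^{j−j′})²`, budget `t := L²`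
    intro j' hj' q hq
    have hq' := norm_grad_le_of_mem_regionOfSet_cover_image_cube (N := N) hρ1 hinj hηpos
      (R := fun j' => 2 * ((F.P K).eta j * r * (((F.P K).L : ℝ) ^ 2 * ((((F.P K).L : ℝ) ^ j' * (F.P K).eta j) ^ 2)⁻¹)) * ((F.P K).eta j)⁻¹)
      (fun xx hxx μ => hA0 xx (by rw [hsqZ 0 (by omega)]; exact hxx) μ) hgradZ hj' q hq
    refine hq'.trans_lt ?_
    show 2 * ((F.P K).eta j * r * (((F.P K).L : ℝ) ^ 2 * ((((F.P K).L : ℝ) ^ j' * (F.P K).eta j) ^ 2)⁻¹)) * ((F.P K).eta j)⁻¹ <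
      κ * ε j * ((F.P K).L : ℝ) ^ (2 * (j - j'))
    rw [← inv_pow, pow_mul_eta_inv_eq (F.P K) hj', pow_mul']
    have hpos : (0 : ℝ) < (((F.P K).L : ℝ) ^ (j - j')) ^ 2 := by positivity
    have := hrow _ (by positivity) (hLpow 2 (by norm_num))
    have hre : 2 * ((F.P K).eta j * r * (((F.P K).L : ℝ) ^ 2 * (((F.P K).L : ℝ) ^ (j - j')) ^ 2)) * ((F.P K).eta j)⁻¹ =
        2 * (r * ((F.P K).L : ℝ) ^ 2) * (((F.P K).L : ℝ) ^ (j - j')) ^ 2 := by field_simp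
    rw [hre]
    exact mul_lt_mul_of_pos_right this hpos
  · -- row 4 (box letter `2rL`), budget `t := L`
    intro b hb
    exact (h2 b hb).trans_lt (by
      have := hrow _ hL0 (by simpa using hLpow 1 (by norm_num))
      simpa [mul_comm, mul_left_comm, mul_assoc] using this)
  · -- row 5 (box gradient `2rL²`), budget `t := L²`
    intro q hq
    exact (h3 q hq).trans_lt (by
      have := hrow _ (by positivity) (hLpow 2 (by norm_num))
      simpa [mul_comm, mul_left_comm, mul_assoc] using this)
  · -- row 6, budget `t := L³`
    intro b hb
    exact (h4c b hb).trans_lt (by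
      have := hrow _ (by positivity) (hLpow 3 (by norm_num))
      simpa [mul_comm, mul_left_comm, mul_assoc] using this)
  · -- row 7, budget `t := L³`
    intro b hb
    exact (h4'' b hb).trans_lt (by
      have := hrow _ (by positivity) (hLpow 3 (by norm_num))
      simpa [mul_comm, mul_left_comm, mul_assoc] using this)

end Summit.QuantumFields.YangMills.BalabanUVNodes.N07Thm4Rows152OfRecordDoorRows

end
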